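import Mathlib
import HarnessLib.Audit
import Summits.PneNP.PneNP.Theorems.PstarUnion
import Summits.PneNP.PneNP.Theorems.PstarChordBridgeExchange

/-!
# PLAN B for the fresh class: COVERS — a union-terminal core is covered by two minimal cores (ROUND-24, memo §14.5–§14.6)

FRONTIER range-avoidance ladder, rung F-N3, ROUND 24 (cell `pnp-ideate`, planner memo `r24/CORE-BOUND-NOTES.md` §14.5 (ladder tolerance: the `h = 2`
rung takes ANY absolute core constant) and §14.6 (PLAN B = COVERS + TIPS for the whole fresh class of O2, no chamber coherence); restricted-model proof
complexity — nothing here bears on `P` versus `NP`).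

* `TerminalNC` — `PstarCoreBoundTargets.Terminal` for a G-pair `(A, w)` MINUS `XorClosed` (a ⊆-minimal infeasible sub-family need not be XOR-closed);
* `TipsChainBound c` (OPEN for every `c`, the target of the TIPS CHAIN, memo §14.6 T1–T4; expected `c = 7`, likely `5`): every `TerminalNC` core with
  Assumption-A data and privates unread has at most `c` outputs;
* `exists_minimal_core`, `cover_subset_core` — an infeasible pair has a ⊆-minimal infeasible sub-family, and every such contains the pair's COVER
  `{f : J₀ ∖ f feasible}`;
* `unionBound_of_tipsChain` — **COVERS**: `UnionTerminal` + F-data + privates unread + `TipsChainBound c` ⟹ `#J₀ ≤ 2c` (`J₀ = P₀ ∪ P₁ ⊆ M₀ ∪ M₁`; each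
  `Mᵢ` inherits F-data by `exists_maximal_peelable_sup` and hun by monotonicity of `privs`; only `Peelable F` and the chord property of `J₀ ∖ F`
  are needed, not the maximality of `F`);
* `unionTerminal_of_fresh`, `terminalFresh_le_of_tipsChain` — hence every terminal core of the FRESH class (`PstarUnion.Fresh z`, all other monomials
  off the privates) has at most `2c` outputs: the fresh class of O2 with constant `2c`, enough for the rung (§14.5);
* `satPair_of_free_tip` — (T1) of the tips chain: an output with an unread XOR tip is droppable.
-/

set_option linter.dupNamespace false -- `Summit.PneNP.PneNP.…`: summit = sub-problem name (D-0017 single-conjunct layout)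

open Finset Literature.Computability.Complexity
open scoped symmDiff
open Summit.PneNP.PneNP.Theorems.PstarTyped (Typed)
open Summit.PneNP.PneNP.Theorems.PstarSALevel (varSet bdry BoundaryExpanding SimpleOverlap)
open Summit.PneNP.PneNP.Theorems.PstarGapPeeling (eval_update_of_not_mem eval_update_xor_slot)
open Summit.PneNP.PneNP.Theorems.PstarCentreFree (vars_mem_varSet)
open Summit.PneNP.PneNP.Theorems.PstarGapOneAll (gval)
open Summit.PneNP.PneNP.Theorems.PstarGConstraint (gval_update_of_forall_ne)
open Summit.PneNP.PneNP.Theorems.PstarCoreBound (XorClosed)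
open Summit.PneNP.PneNP.Theorems.PstarChordRepair (IsChord)
open Summit.PneNP.PneNP.Theorems.PstarChordBridgeCotree (Peelable)
open Summit.PneNP.PneNP.Theorems.PstarChordBridgeTools (privs mem_privs)
open Summit.PneNP.PneNP.Theorems.PstarChordBridgeExchange (privs_mono)
open Summit.PneNP.PneNP.Theorems.PstarChordBridgeCentre (exists_maximal_peelable_sup)
open Summit.PneNP.PneNP.Theorems.PstarNorUnitDirAssembly (mem_bdry_of_subset)
open Summit.PneNP.PneNP.Theorems.PstarCoreBoundTargets (Terminal)
open Summit.PneNP.PneNP.Theorems.PstarUnion (Fresh partA partAB SatPair UnionTerminal sat_split_fresh)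

namespace Summit.PneNP.PneNP.Theorems.PstarUnionCovers

variable {n m : ℕ}

/-! ## Terminal without XOR-closure, and the tips-chain target -/

/-- **`Terminal` minus `XorClosed`** for a G-pair `(A, w)`: `M` non-empty, `#M < r`, monomials off `M` inside the radius, the pair infeasible over the
equations of `M` and feasible after deleting any one of them. -/
def TerminalNC (I : LocalMap 4 n m) (r : ℕ) (y : Fin m → Bool) (M : Finset (Fin m)) (A w : Finset (Fin n) × Finset (Fin m) × Bool) : Prop :=
  M.Nonempty ∧ M.card < r ∧ Disjoint M A.2.1 ∧ Disjoint M w.2.1 ∧ (M ∪ A.2.1 ∪ w.2.1).card ≤ r ∧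
    ¬ SatPair I y M A w ∧ ∀ f ∈ M, SatPair I y (M.erase f) A w

/-- **The TIPS-CHAIN bound with constant `c` (OPEN; memo §14.6 T1–T4, expected `c = 7`):** every `TerminalNC` core carrying a maximal leaf-peelable `F`
whose co-edges are chords, with privates unread, has at most `c` outputs.  FRONTIER. -/
@[conjecture] def TipsChainBound (c : ℕ) : Prop :=
  ∀ (n m r : ℕ) (I : LocalMap 4 n m), I.IsPure xorAndPred → Typed I → SimpleOverlap I → BoundaryExpanding r I →
    ∀ (y : Fin m → Bool) (M : Finset (Fin m)) (A w : Finset (Fin n) × Finset (Fin m) × Bool), TerminalNC I r y M A w →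
    ∀ F ⊆ M, Peelable I F → (∀ F', F ⊆ F' → F' ⊆ M → Peelable I F' → F' = F) → (∀ e ∈ M \ F, IsChord I M e) →
    (∀ g ∈ A.2.1 ∪ w.2.1, ∀ v ∈ privs I (M \ F), I.vars g 2 ≠ v ∧ I.vars g 3 ≠ v) → M.card ≤ c

/-! ## Minimal cores and covers -/

/-- Fewer equations are easier to satisfy. -/
theorem satPair_mono (I : LocalMap 4 n m) (y : Fin m → Bool) {E E' : Finset (Fin m)} (h : E' ⊆ E) {A w : Finset (Fin n) × Finset (Fin m) × Bool}
    (hs : SatPair I y E A w) : SatPair I y E' A w := by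
  obtain ⟨x, hx, hA, hw⟩ := hs
  exact ⟨x, fun j hj => hx j (h hj), hA, hw⟩

/-- **An infeasible pair has a ⊆-minimal infeasible sub-family.** -/
theorem exists_minimal_core (I : LocalMap 4 n m) (y : Fin m → Bool) {J : Finset (Fin m)} {A w : Finset (Fin n) × Finset (Fin m) × Bool}
    (h : ¬ SatPair I y J A w) : ∃ M ⊆ J, ¬ SatPair I y M A w ∧ ∀ f ∈ M, SatPair I y (M.erase f) A w := by
  classical
  let P : Finset (Finset (Fin m)) := J.powerset.filter fun M => ¬ SatPair I y M A w
  obtain ⟨M, hM, hmin⟩ := exists_min_image P Finset.card ⟨J, mem_filter.2 ⟨mem_powerset.2 (Subset.refl _), h⟩⟩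
  rw [mem_filter, mem_powerset] at hM
  refine ⟨M, hM.1, hM.2, fun f hf => ?_⟩
  by_contra hs
  have := hmin (M.erase f) (mem_filter.2 ⟨mem_powerset.2 ((erase_subset f M).trans hM.1), hs⟩)
  have := card_erase_lt_of_mem hf
  omega

/-- **The cover lies in every infeasible sub-family**: if `J ∖ f` is feasible then every infeasible `M ⊆ J` contains `f`. -/
theorem cover_subset_core (I : LocalMap 4 n m) (y : Fin m → Bool) {J M : Finset (Fin m)} (hM : M ⊆ J)
    {A w : Finset (Fin n) × Finset (Fin m) × Bool} (hinf : ¬ SatPair I y M A w) {f : Fin m} (hf : SatPair I y (J.erase f) A w) : f ∈ M := by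
  by_contra hfM
  exact hinf (satPair_mono I y (fun j hj => mem_erase.2 ⟨fun h => hfM (by rwa [h] at hj), hM hj⟩) hf)

/-- **A minimal core inside `J₀` inherits Assumption-A data and privates-unread, hence the tips-chain bound.** -/
theorem card_core_le (c : ℕ) (hTC : TipsChainBound c) (I : LocalMap 4 n m) (hI : I.IsPure xorAndPred) (hT : Typed I) (hS : SimpleOverlap I)
    {r : ℕ} (hB : BoundaryExpanding r I) (y : Fin m → Bool) {J₀ M : Finset (Fin m)} (hMJ : M ⊆ J₀) (hJr : J₀.card < r)
    {A w : Finset (Fin n) × Finset (Fin m) × Bool} (hdA : Disjoint J₀ A.2.1) (hdw : Disjoint J₀ w.2.1) (hr : (J₀ ∪ A.2.1 ∪ w.2.1).card ≤ r)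
    (hinf : ¬ SatPair I y M A w) (hmin : ∀ f ∈ M, SatPair I y (M.erase f) A w)
    {F : Finset (Fin m)} (hP : Peelable I F) (hchord : ∀ e ∈ J₀ \ F, IsChord I J₀ e) (hun : ∀ g ∈ A.2.1 ∪ w.2.1, ∀ v ∈ privs I (J₀ \ F), I.vars g 2 ≠ v ∧ I.vars g 3 ≠ v) :
    M.card ≤ c := by
  classical
  rcases M.eq_empty_or_nonempty with rfl | hne
  · simp
  -- Assumption-A data for `M`: a maximal peelable `F' ⊇ F ∩ M`
  obtain ⟨F', hFF', hF'M, hPF', hmax'⟩ := exists_maximal_peelable_sup I (inter_subset_right : F ∩ M ⊆ M) (hP.subset inter_subset_left)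
  have hTNC : TerminalNC I r y M A w :=
    ⟨hne, (card_le_card hMJ).trans_lt hJr, hdA.mono_left hMJ, hdw.mono_left hMJ,
      (card_le_card (union_subset_union (union_subset_union hMJ (Subset.refl _)) (Subset.refl _))).trans hr, hinf, hmin⟩
  refine hTC n m r I hI hT hS hB y M A w hTNC F' hF'M hPF' hmax' (fun e he => ?_) (fun g hg v hv => ?_)
  · rw [mem_sdiff] at he
    have heF : e ∉ F := fun h => he.2 (hFF' (mem_inter.2 ⟨h, he.1⟩))
    obtain ⟨h2, h3⟩ := hchord e (mem_sdiff.2 ⟨hMJ he.1, heF⟩)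
    exact ⟨mem_bdry_of_subset I hMJ he.1 (vars_mem_varSet I e 2) h2, mem_bdry_of_subset I hMJ he.1 (vars_mem_varSet I e 3) h3⟩
  · refine hun g hg v (privs_mono I (fun e he => ?_) hv)
    rw [mem_sdiff] at he ⊢
    exact ⟨hMJ he.1, fun h => he.2 (hFF' (mem_inter.2 ⟨h, he.1⟩))⟩

/-! ## COVERS -/

/-- **COVERS (memo §14.6): a union-terminal core is covered by two minimal cores, so `TipsChainBound c` bounds it by `2c`.** -/
theorem unionBound_of_tipsChain (c : ℕ) (hTC : TipsChainBound c) (I : LocalMap 4 n m) (hI : I.IsPure xorAndPred) (hT : Typed I)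
    (hS : SimpleOverlap I) {r : ℕ} (hB : BoundaryExpanding r I) (y : Fin m → Bool) {J₀ : Finset (Fin m)}
    {A₀ A₁ w₂ : Finset (Fin n) × Finset (Fin m) × Bool} (hU : UnionTerminal I r y J₀ A₀ A₁ w₂)
    {F : Finset (Fin m)} (hP : Peelable I F) (hchord : ∀ e ∈ J₀ \ F, IsChord I J₀ e)
    (hun : ∀ g ∈ A₀.2.1 ∪ w₂.2.1, ∀ v ∈ privs I (J₀ \ F), I.vars g 2 ≠ v ∧ I.vars g 3 ≠ v) : J₀.card ≤ 2 * c := by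
  classical
  obtain ⟨-, -, hJr, hG, hd₀, hd₂, hr, -, hinf₀, hinf₁, hcover⟩ := hU
  obtain ⟨M₀, hM₀, hinfM₀, hminM₀⟩ := exists_minimal_core I y hinf₀
  obtain ⟨M₁, hM₁, hinfM₁, hminM₁⟩ := exists_minimal_core I y hinf₁
  have hun₁ : ∀ g ∈ A₁.2.1 ∪ w₂.2.1, ∀ v ∈ privs I (J₀ \ F), I.vars g 2 ≠ v ∧ I.vars g 3 ≠ v := by rw [hG]; exact hun
  have h₀ := card_core_le c hTC I hI hT hS hB y hM₀ hJr hd₀ hd₂ hr hinfM₀ hminM₀ hP hchord hun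
  have h₁ := card_core_le c hTC I hI hT hS hB y hM₁ hJr (by rw [hG]; exact hd₀) hd₂ (by rw [hG]; exact hr) hinfM₁ hminM₁ hP hchord hun₁
  have hsub : J₀ ⊆ M₀ ∪ M₁ := fun f hf => by
    rcases hcover f hf with h | h
    · exact mem_union_left _ (cover_subset_core I y hM₀ hinfM₀ h)
    · exact mem_union_right _ (cover_subset_core I y hM₁ hinfM₁ h)
  calc J₀.card ≤ (M₀ ∪ M₁).card := card_le_card hsub
    _ ≤ M₀.card + M₁.card := card_union_le _ _
    _ ≤ 2 * c := by omega

/-! ## The fresh class -/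

/-- **A terminal core with a fresh `z` is union-terminal for `(partA, partAB, w₂)`** (the reduction inside `PstarUnion.terminalFiveFresh_of_unionFive`). -/
theorem unionTerminal_of_fresh (I : LocalMap 4 n m) (hT : Typed I) {r : ℕ} {y : Fin m → Bool} {J₀ : Finset (Fin m)}
    {w₁ w₂ : Finset (Fin n) × Finset (Fin m) × Bool} {z : Fin n} (ht : Terminal I r y J₀ w₁ w₂) (hz : Fresh I J₀ w₁ w₂ z) :
    UnionTerminal I r y J₀ (partA I w₁ z) (partAB I w₁ z) w₂ := by
  classical
  obtain ⟨hne, hX, hJr, hd₁, hd₂, hr, hT3, hM0⟩ := ht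
  have hsub : (partA I w₁ z).2.1 ⊆ w₁.2.1 := filter_subset _ _
  refine ⟨hne, hX, hJr, rfl, hd₁.mono_right hsub, hd₂,
    (card_le_card (union_subset_union (union_subset_union (Subset.refl J₀) hsub) (Subset.refl _))).trans hr, ?_, ?_, ?_, ?_⟩
  · intro v hv j hj
    have hv' : v ∈ (w₁.2.1.filter fun g => I.vars g 3 = z).image fun g => I.vars g 2 := by
      unfold PstarUnion.partA PstarUnion.partAB at hv
      simpa [symmDiff_symmDiff_cancel_left] using hv
    obtain ⟨g, -, rfl⟩ := mem_image.1 hv'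
    exact ⟨hT j g 0 2 (by decide) (by decide), hT j g 1 2 (by decide) (by decide)⟩
  · exact fun h => hT3 ((sat_split_fresh I (Subset.refl J₀) y hz).2 (Or.inl h))
  · exact fun h => hT3 ((sat_split_fresh I (Subset.refl J₀) y hz).2 (Or.inr h))
  · exact fun f hf => (sat_split_fresh I (erase_subset f J₀) y hz).1 (hM0 f hf)

/-- **The fresh class of O2 with constant `2c`** (memo §14.6: `TipsChainBound c` ⟹ every terminal core whose privates-reading monomials are gates
on one fresh `z` has at most `2c` outputs — `PstarUnion.TerminalFiveFresh` with `5` replaced by `2c`). -/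
theorem terminalFresh_le_of_tipsChain (c : ℕ) (hTC : TipsChainBound c) (I : LocalMap 4 n m) (hI : I.IsPure xorAndPred) (hT : Typed I)
    (hS : SimpleOverlap I) {r : ℕ} (hB : BoundaryExpanding r I) (y : Fin m → Bool) {J₀ : Finset (Fin m)}
    {w₁ w₂ : Finset (Fin n) × Finset (Fin m) × Bool} {z : Fin n} (ht : Terminal I r y J₀ w₁ w₂) (hz : Fresh I J₀ w₁ w₂ z)
    {F : Finset (Fin m)} (hP : Peelable I F) (hchord : ∀ e ∈ J₀ \ F, IsChord I J₀ e)
    (hun : ∀ g ∈ w₁.2.1 ∪ w₂.2.1, I.vars g 3 ≠ z → ∀ v ∈ privs I (J₀ \ F), I.vars g 2 ≠ v ∧ I.vars g 3 ≠ v) : J₀.card ≤ 2 * c := by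
  refine unionBound_of_tipsChain c hTC I hI hT hS hB y (unionTerminal_of_fresh I hT ht hz) hP hchord fun g hg v hv => ?_
  rcases mem_union.1 hg with h | h
  · exact hun g (mem_union_left _ (mem_filter.1 h).1) (mem_filter.1 h).2 v hv
  · exact hun g (mem_union_right _ h) (hz.2.2.1 g h).2 v hv

/-! ## (T1) Tips are read -/

/-- **(T1) of the tips chain: an output with an UNREAD XOR TIP is droppable.**  If an XOR-slot variable `x` of `f ∈ M` occurs in no other output of
`M`, in neither linear part and in no monomial, then solvability over `M ∖ f` gives solvability over `M` (set `x` last). -/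
theorem satPair_of_free_tip (I : LocalMap 4 n m) (hI : I.IsPure xorAndPred) (y : Fin m → Bool) {M : Finset (Fin m)}
    {A w : Finset (Fin n) × Finset (Fin m) × Bool} {f : Fin m} (hf : f ∈ M) {s : Fin 4} (hs : s.val < 2)
    (htip : ∀ j ∈ M, j ≠ f → I.vars f s ∉ varSet I j) (hlin : I.vars f s ∉ A.1 ∧ I.vars f s ∉ w.1)
    (hmono : ∀ g ∈ A.2.1 ∪ w.2.1, I.vars g 2 ≠ I.vars f s ∧ I.vars g 3 ≠ I.vars f s)
    (h : SatPair I y (M.erase f) A w) : SatPair I y M A w := by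
  obtain ⟨x, hx, hA, hw⟩ := h
  by_cases hfx : I.eval x f = y f
  · exact ⟨x, fun j hj => if hjf : j = f then hjf ▸ hfx else hx j (mem_erase.2 ⟨hjf, hj⟩), hA, hw⟩
  · refine ⟨Function.update x (I.vars f s) (!x (I.vars f s)), fun j hj => ?_, ?_, ?_⟩
    · by_cases hjf : j = f
      · subst hjf
        rw [eval_update_xor_slot I hI x j s hs]
        revert hfx
        cases I.eval x j <;> cases y j <;> simp
      · rw [eval_update_of_not_mem I j x (htip j hj hjf)]
        exact hx j (mem_erase.2 ⟨hjf, hj⟩)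
    · rw [gval_update_of_forall_ne I x hlin.1 (fun g hg => hmono g (mem_union_left _ hg))]
      exact hA
    · rw [gval_update_of_forall_ne I x hlin.2 (fun g hg => hmono g (mem_union_right _ hg))]
      exact hw

end Summit.PneNP.PneNP.Theorems.PstarUnionCovers
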